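import Literature.NumberTheory.EllipticCurves.IwasawaAlgebraRankOneIdealProofs
import HarnessLib

/-!
# The index ideal `J(s) = {φ(s) : φ ∈ Hom_Λ(H, Λ)}` of an element of a rank-one torsion-free
# `Λ`-module versus the quotient `H ⧸ Λs`: equal local lengths at every height-one prime, equal
# characteristic ideals (module theory over `Λ = ℤ_p⟦T⟧`; proofs file)

Topic `NumberTheory/EllipticCurves`.  Theorems only (no definition, no named fact, no `sorry`), on the
vocabulary of `IwasawaAlgebra.lean` (`Module.lengthAt`, `Module.charIdeal`, `Module.IsPseudoNull`) and
`IwasawaAlgebraRankOneIdealProofs.lean` (the rank-one reflexive hull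
`IwasawaAlgebra.exists_linearEquiv_ideal_finite_quotient`).  Cell `bsd-potss` (HOME
`run/shared/lean/pub/bsd-potss/`), seat `bsd-potss-k8q-c2x` g6 (prover; lane B of the K8 Kato side,
rung K8-Gss2 of `BirchSwinnertonDyer`).  HONEST FRAMING: pure commutative algebra; nothing about elliptic
curves is asserted; BSD is not proved by any of this.

## Why (the reading flag `Kato-134-J-quotient` of the named fact
## `Kato2004.thm13_4_lengthAt_fineSelmerDual_le_of_isEulerSystemClass`, and Rubin's `ind_Λ(c)`)

Kato, Astérisque 295 (2004), Thm. 13.4 (p. 226) bounds `length_{Λ_𝔭}(𝐇²(T)_{0,𝔭})` by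
`length_{Λ_𝔭}(Λ_𝔭/J_𝔭)`, where "`J` [is] the ideal of `Λ` generated by `h(Z)` for all `Λ`-homomorphisms
`h : 𝐇¹(T) → Λ`"; K. Rubin, *Euler Systems* (2000), §2.3 calls the same ideal for a cyclic `Z = Λc` the
index of divisibility `ind_Λ(c) = {φ(c) : φ ∈ Hom_Λ(H¹_∞(K,T), Λ)}` (Thm. 2.3.3: `char(X_∞) ∣ ind_Λ(c)`).
The tree's transcription of Kato 13.4 for `T = T_pW` (seat k8q-c2x g2, flag `Kato-134-J-quotient`) reads
`length_{Λ_𝔭}(Λ_𝔭/J_𝔭)` as `ℓ_𝔭(𝐇¹_Γ ⧸ Λs)`, justified in prose by "`𝐇¹(T)` is torsion free of rank one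
(Thm. 12.4 (2))".  THIS FILE proves that reading as a theorem of module theory over `Λ`: for every
finitely generated torsion-free `Λ`-module `H` of rank one and every `s ∈ H`, `s ≠ 0`,

* `IwasawaAlgebra.lengthAt_quotient_indexIdeal_eq` — `ℓ_𝔭(Λ ⧸ J(s)) = ℓ_𝔭(H ⧸ Λs)` at EVERY height-one
  prime `𝔭` of `Λ` (including `(p)`), where `J(s) = range(φ ↦ φ s : Hom_Λ(H, Λ) → Λ)`;
* `IwasawaAlgebra.charIdeal_quotient_indexIdeal_eq` — `char(Λ ⧸ J(s)) = char(H ⧸ Λs)`;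
* `IwasawaAlgebra.lengthAt_quotient_indexIdeal_eq_of_injective` — the same with "rank one" replaced by
  "`H` embeds in `Λ` and `s ≠ 0`" (the shape in which Kobayashi's injective Coleman map and a non-zero
  Euler-system class present `𝐇¹_Γ(T_pW)` on rung K8).

Proof.  By the rank-one reflexive hull (Bourbaki AC VII §4 no. 2 / Kato 13.14, tree theorem
`exists_linearEquiv_ideal_finite_quotient`) `H ≅ 𝔟` for an ideal `𝔟 ≤ Λ` of FINITE index; let `x ∈ 𝔟`
correspond to `s`.  Then `(x) ≤ J(s)` (the inclusion `𝔟 ↪ Λ` is a functional), and `b · J(s) ≤ (x)` for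
every `b ∈ 𝔟` (`b φ(x) = φ(bx) = x φ(b)`).  A finite `Λ`-module is pseudo-null
(`isPseudoNull_of_finite`), so at a height-one `𝔭` some `b ∈ 𝔟` lies outside `𝔭`; hence the kernel
`J(s)/(x)` of `Λ/(x) ↠ Λ/J(s)` is killed by an element outside `𝔭` and has `ℓ_𝔭 = 0`, and
`ℓ_𝔭(Λ/J(s)) = ℓ_𝔭(Λ/(x)) = ℓ_𝔭(𝔟/Λx) + ℓ_𝔭(Λ/𝔟) = ℓ_𝔭(H/Λs) + 0`.

References: [Kato2004Asterisque] Thm. 13.4 (p. 226), Thm. 12.4 (2) (p. 221), 13.14 (p. 234);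
[Rubin2000] §2.3 (the index of divisibility `ind_Λ(c)`, Thm. 2.3.3); [BourbakiAC5to7] Ch. VII §4
no. 2 and no. 4–5.
-/

noncomputable section

open scoped Classical

namespace Literature.NumberTheory.EllipticCurves

namespace IwasawaAlgebra

variable {p : ℕ} [Fact p.Prime]
variable {H : Type*} [AddCommGroup H] [_root_.Module (IwasawaAlgebra p) H]

/-! ## §1 Two elementary length computations -/

/-- A module killed by an element outside `𝔭` has local length `0` at `𝔭` (its localisation at `𝔭`
vanishes). [folklore] -/
private theorem lengthAt_eq_zero_of_smul_eq_zero {M : Type*} [AddCommGroup M]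
    [_root_.Module (IwasawaAlgebra p) M] {b : IwasawaAlgebra p} (𝔭 : PrimeSpectrum (IwasawaAlgebra p))
    (hb : b ∉ 𝔭.asIdeal) (hM : ∀ m : M, b • m = 0) : Module.lengthAt (IwasawaAlgebra p) M 𝔭 = 0 := by
  rw [Module.lengthAt_eq_zero_iff, LocalizedModule.subsingleton_iff]
  exact fun m ↦ ⟨b, hb, hM m⟩

/-- For an ideal `𝔟 ≤ Λ` of finite index and `x ∈ 𝔟`: `ℓ_𝔭(Λ/(x)) = ℓ_𝔭(𝔟/Λx)` at every height-one
prime `𝔭` — from the exact sequence `0 → 𝔟/Λx → Λ/(x) → Λ/𝔟 → 0` and `ℓ_𝔭(Λ/𝔟) = 0` (a finite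
`Λ`-module is pseudo-null). [cite: BourbakiAC5to7, Ch. VII §4 no. 4–5 (pseudo-null modules, additivity of lengths)] -/
theorem lengthAt_quotient_span_singleton_eq_of_finite_quotient (𝔟 : Ideal (IwasawaAlgebra p))
    [Finite (IwasawaAlgebra p ⧸ 𝔟)] {x : IwasawaAlgebra p} (hx : x ∈ 𝔟)
    (𝔭 : PrimeSpectrum (IwasawaAlgebra p)) (h𝔭 : 𝔭.asIdeal.height = 1) :
    Module.lengthAt (IwasawaAlgebra p) (IwasawaAlgebra p ⧸ Ideal.span {x}) 𝔭 =
      Module.lengthAt (IwasawaAlgebra p) (𝔟 ⧸ (IwasawaAlgebra p) ∙ (⟨x, hx⟩ : 𝔟)) 𝔭 := by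
  set x' : 𝔟 := ⟨x, hx⟩ with hx'
  have hcomap : (IwasawaAlgebra p) ∙ x' ≤ Submodule.comap 𝔟.subtype (Ideal.span {x}) := by
    rw [Submodule.span_singleton_le_iff_mem, Submodule.mem_comap, Submodule.subtype_apply]
    exact Ideal.mem_span_singleton_self x
  let f : (𝔟 ⧸ (IwasawaAlgebra p) ∙ x') →ₗ[IwasawaAlgebra p] (IwasawaAlgebra p ⧸ Ideal.span {x}) :=
    Submodule.mapQ _ _ 𝔟.subtype hcomap
  have hle : Ideal.span {x} ≤ 𝔟 := (Ideal.span_singleton_le_iff_mem _).mpr hx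
  let g : (IwasawaAlgebra p ⧸ Ideal.span {x}) →ₗ[IwasawaAlgebra p] (IwasawaAlgebra p ⧸ 𝔟) :=
    Submodule.factor hle
  have hf : Function.Injective f := by
    rw [injective_iff_map_eq_zero]
    intro y hy
    obtain ⟨b, rfl⟩ := Submodule.Quotient.mk_surjective _ y
    simp only [f, Submodule.mapQ_apply, Submodule.subtype_apply, Submodule.Quotient.mk_eq_zero,
      Ideal.mem_span_singleton'] at hy
    obtain ⟨c, hc⟩ := hy
    rw [Submodule.Quotient.mk_eq_zero]
    refine Submodule.mem_span_singleton.mpr ⟨c, Subtype.ext ?_⟩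
    change c * x = (b : IwasawaAlgebra p)
    exact hc
  have hg : Function.Surjective g := by
    intro y
    obtain ⟨r, rfl⟩ := Submodule.Quotient.mk_surjective _ y
    exact ⟨Submodule.Quotient.mk r, rfl⟩
  have hfg : Function.Exact f g := by
    intro y
    obtain ⟨r, rfl⟩ := Submodule.Quotient.mk_surjective _ y
    constructor
    · intro hy
      have hy' : Submodule.Quotient.mk (p := 𝔟) r = 0 := hy
      rw [Submodule.Quotient.mk_eq_zero] at hy'
      exact ⟨Submodule.Quotient.mk ⟨r, hy'⟩, rfl⟩
    · rintro ⟨z, hz⟩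
      obtain ⟨b, rfl⟩ := Submodule.Quotient.mk_surjective _ z
      simp only [f, Submodule.mapQ_apply, Submodule.subtype_apply] at hz
      rw [← hz]
      show Submodule.Quotient.mk (p := 𝔟) (b : IwasawaAlgebra p) = 0
      rw [Submodule.Quotient.mk_eq_zero]
      exact b.2
  have h0 : Module.lengthAt (IwasawaAlgebra p) (IwasawaAlgebra p ⧸ 𝔟) 𝔭 = 0 :=
    (Module.lengthAt_eq_zero_iff 𝔭).mpr
      (isPseudoNull_of_finite p (IwasawaAlgebra p ⧸ 𝔟) 𝔭 (le_of_eq h𝔭))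
  rw [Module.lengthAt_eq_add_of_exact f g hf hg hfg 𝔭, h0, add_zero]

/-! ## §2 The index ideal of an element of an ideal of finite index -/

/-- For an ideal `𝔟 ≤ Λ`, `x ∈ 𝔟` and any functional `φ : 𝔟 → Λ`: `b · φ(x) = x · φ(b)` for every
`b ∈ 𝔟` (both equal `φ(bx)`). [folklore] -/
private theorem mul_apply_eq_mul_apply (𝔟 : Ideal (IwasawaAlgebra p))
    (φ : 𝔟 →ₗ[IwasawaAlgebra p] IwasawaAlgebra p) (x b : 𝔟) :
    (b : IwasawaAlgebra p) * φ x = (x : IwasawaAlgebra p) * φ b := by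
  have h1 : (b : IwasawaAlgebra p) • x = (x : IwasawaAlgebra p) • b := by
    apply Subtype.ext
    change (b : IwasawaAlgebra p) * (x : IwasawaAlgebra p) = (x : IwasawaAlgebra p) * b
    exact mul_comm _ _
  rw [← smul_eq_mul, ← map_smul, h1, map_smul, smul_eq_mul]

/-- **The index ideal of an element of an ideal of finite index has the local lengths of the
principal ideal it generates.** For `𝔟 ≤ Λ` of finite index, `x ∈ 𝔟`, and
`J = {φ(x) : φ ∈ Hom_Λ(𝔟, Λ)}`: `(x) ≤ J`, `𝔟 · J ≤ (x)`, hence `ℓ_𝔭(Λ/J) = ℓ_𝔭(Λ/(x))` at every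
height-one `𝔭` (some element of `𝔟` lies outside `𝔭`, a finite module being pseudo-null).
[cite: Kato2004Asterisque, Thm. 13.4 (p. 226: the ideal J) and 13.14 (p. 234)]
[cite: BourbakiAC5to7, Ch. VII §4 no. 2 and no. 4] -/
theorem lengthAt_quotient_range_eval_eq_of_finite_quotient (𝔟 : Ideal (IwasawaAlgebra p))
    [Finite (IwasawaAlgebra p ⧸ 𝔟)] (x : 𝔟)
    (𝔭 : PrimeSpectrum (IwasawaAlgebra p)) (h𝔭 : 𝔭.asIdeal.height = 1) :
    Module.lengthAt (IwasawaAlgebra p)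
        (IwasawaAlgebra p ⧸ LinearMap.range (Module.Dual.eval (IwasawaAlgebra p) 𝔟 x)) 𝔭 =
      Module.lengthAt (IwasawaAlgebra p) (IwasawaAlgebra p ⧸ Ideal.span {(x : IwasawaAlgebra p)}) 𝔭 := by
  set J : Ideal (IwasawaAlgebra p) := LinearMap.range (Module.Dual.eval (IwasawaAlgebra p) 𝔟 x)
    with hJdef
  -- `(x) ≤ J`: the inclusion `𝔟 ↪ Λ` is a functional
  have hxJ : Ideal.span {(x : IwasawaAlgebra p)} ≤ J := by
    rw [Ideal.span_singleton_le_iff_mem, hJdef]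
    exact ⟨𝔟.subtype, rfl⟩
  -- `b • J ≤ (x)` for `b ∈ 𝔟`
  have hbJ : ∀ (b : 𝔟) (j : IwasawaAlgebra p), j ∈ J →
      (b : IwasawaAlgebra p) * j ∈ Ideal.span {(x : IwasawaAlgebra p)} := by
    rintro b j ⟨φ, rfl⟩
    rw [Module.Dual.eval_apply, mul_apply_eq_mul_apply 𝔟 φ x b]
    exact Ideal.mul_mem_right _ _ (Ideal.mem_span_singleton_self _)
  -- some `b ∈ 𝔟` outside `𝔭`
  have hsub : Subsingleton (LocalizedModule 𝔭.asIdeal.primeCompl (IwasawaAlgebra p ⧸ 𝔟)) :=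
    isPseudoNull_of_finite p (IwasawaAlgebra p ⧸ 𝔟) 𝔭 (le_of_eq h𝔭)
  obtain ⟨b, hb𝔭, hb⟩ := (LocalizedModule.subsingleton_iff.mp hsub)
    (Submodule.Quotient.mk (p := 𝔟) (1 : IwasawaAlgebra p))
  have hb𝔟 : (b : IwasawaAlgebra p) ∈ 𝔟 := by
    rw [← Submodule.Quotient.mk_smul, Submodule.Quotient.mk_eq_zero, smul_eq_mul, mul_one] at hb
    exact hb
  -- the surjection `Λ/(x) ↠ Λ/J` and its kernel, killed by `b`
  let π : (IwasawaAlgebra p ⧸ Ideal.span {(x : IwasawaAlgebra p)}) →ₗ[IwasawaAlgebra p]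
      (IwasawaAlgebra p ⧸ J) := Submodule.factor hxJ
  have hπ : Function.Surjective π := by
    intro y
    obtain ⟨r, rfl⟩ := Submodule.Quotient.mk_surjective _ y
    exact ⟨Submodule.Quotient.mk r, rfl⟩
  have hker : ∀ k : LinearMap.ker π, (b : IwasawaAlgebra p) • k = 0 := by
    rintro ⟨k, hk⟩
    obtain ⟨r, rfl⟩ := Submodule.Quotient.mk_surjective _ k
    apply Subtype.ext
    change (b : IwasawaAlgebra p) • Submodule.Quotient.mk (p := Ideal.span {(x : IwasawaAlgebra p)}) r = 0
    have hr : Submodule.Quotient.mk (p := J) r = 0 := hk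
    rw [Submodule.Quotient.mk_eq_zero] at hr
    rw [← Submodule.Quotient.mk_smul, Submodule.Quotient.mk_eq_zero, smul_eq_mul]
    exact hbJ ⟨b, hb𝔟⟩ r hr
  have hk0 : Module.lengthAt (IwasawaAlgebra p) (LinearMap.ker π) 𝔭 = 0 :=
    lengthAt_eq_zero_of_smul_eq_zero 𝔭 hb𝔭 hker
  have hexact : Function.Exact (LinearMap.ker π).subtype π :=
    LinearMap.exact_iff.mpr (Submodule.range_subtype _).symm
  rw [Module.lengthAt_eq_add_of_exact (LinearMap.ker π).subtype π (Submodule.subtype_injective _) hπ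
    hexact 𝔭, hk0, zero_add]

/-! ## §3 The index ideal of an element of a rank-one torsion-free module -/

/-- Transport of the index ideal along `e : H ≃ 𝔟`: `{φ(s) : φ ∈ Hom(H, Λ)} = {ψ(e s) : ψ ∈ Hom(𝔟, Λ)}`.
[folklore] -/
private theorem range_eval_eq_of_linearEquiv {N : Type*} [AddCommGroup N]
    [_root_.Module (IwasawaAlgebra p) N] (e : H ≃ₗ[IwasawaAlgebra p] N) (s : H) :
    LinearMap.range (Module.Dual.eval (IwasawaAlgebra p) H s) =
      LinearMap.range (Module.Dual.eval (IwasawaAlgebra p) N (e s)) := by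
  ext j
  simp only [LinearMap.mem_range, Module.Dual.eval_apply]
  constructor
  · rintro ⟨φ, rfl⟩
    exact ⟨φ ∘ₗ e.symm.toLinearMap, by simp⟩
  · rintro ⟨ψ, rfl⟩
    exact ⟨ψ ∘ₗ e.toLinearMap, by simp⟩

/-- **Kato's `Λ_𝔭/J_𝔭` = Rubin's `ind_Λ(s)` versus `H ⧸ Λs`, in rank one.** Let `H` be a finitely
generated torsion-free `Λ`-module of rank `1` (`Λ = ℤ_p⟦T⟧`), `s ∈ H` (any element; for `s = 0`
both sides are the length of a rank-one module), and `J(s) = {φ(s) : φ ∈ Hom_Λ(H, Λ)}` (the range of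
evaluation at `s` on the dual). Then at EVERY height-one prime `𝔭` of `Λ`:
`ℓ_𝔭(Λ ⧸ J(s)) = ℓ_𝔭(H ⧸ Λs)`. (Reflexive hull `H ≅ 𝔟` of finite index; §2; and
`ℓ_𝔭(Λ/(x)) = ℓ_𝔭(𝔟/Λx)`.) This is the reading `Kato-134-J-quotient` of the tree's transcription of
Kato Thm. 13.4, as a theorem. [cite: Kato2004Asterisque, Thm. 13.4 (p. 226) with Thm. 12.4 (2) (p. 221) and 13.14 (p. 234)]
[cite: Rubin2000, §2.3 (ind_Λ(c)) and Thm. 2.3.3] [cite: BourbakiAC5to7, Ch. VII §4 no. 2] -/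
theorem lengthAt_quotient_indexIdeal_eq [Module.Finite (IwasawaAlgebra p) H]
    [_root_.Module.IsTorsionFree (IwasawaAlgebra p) H]
    (hH : Module.rank (IwasawaAlgebra p) H = 1) (s : H)
    (𝔭 : PrimeSpectrum (IwasawaAlgebra p)) (h𝔭 : 𝔭.asIdeal.height = 1) :
    Module.lengthAt (IwasawaAlgebra p)
        (IwasawaAlgebra p ⧸ LinearMap.range (Module.Dual.eval (IwasawaAlgebra p) H s)) 𝔭 =
      Module.lengthAt (IwasawaAlgebra p) (H ⧸ (IwasawaAlgebra p) ∙ s) 𝔭 := by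
  obtain ⟨𝔟, hfin, -, ⟨e⟩⟩ := exists_linearEquiv_ideal_finite_quotient (M := H) hH
  haveI := hfin
  set x : 𝔟 := e s with hxdef
  have hx : (⟨(x : IwasawaAlgebra p), x.2⟩ : 𝔟) = x := rfl
  -- transport both sides along `e`
  rw [range_eval_eq_of_linearEquiv e s, lengthAt_quotient_range_eval_eq_of_finite_quotient 𝔟 x 𝔭 h𝔭,
    lengthAt_quotient_span_singleton_eq_of_finite_quotient 𝔟 x.2 𝔭 h𝔭, hx]
  -- `H ⧸ Λs ≃ 𝔟 ⧸ Λ(e s)`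
  have hmap : Submodule.map (e : H →ₗ[IwasawaAlgebra p] 𝔟) ((IwasawaAlgebra p) ∙ s) =
      (IwasawaAlgebra p) ∙ x := by
    rw [Submodule.map_span, Set.image_singleton]
    rfl
  exact (Module.lengthAt_eq_of_linearEquiv (Submodule.Quotient.equiv _ _ e hmap) 𝔭).symm

/-- **The same, at the level of characteristic ideals**: `char(Λ ⧸ J(s)) = char(H ⧸ Λs)` for `H`
finitely generated torsion-free of rank `1` over `Λ` and any `s ∈ H`.
[cite: Kato2004Asterisque, Thm. 13.4 (p. 226)] [cite: Rubin2000, §2.3 and Thm. 2.3.3]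
[cite: BourbakiAC5to7, Ch. VII §4 no. 5] -/
theorem charIdeal_quotient_indexIdeal_eq [Module.Finite (IwasawaAlgebra p) H]
    [_root_.Module.IsTorsionFree (IwasawaAlgebra p) H]
    (hH : Module.rank (IwasawaAlgebra p) H = 1) (s : H) :
    Module.charIdeal (IwasawaAlgebra p)
        (IwasawaAlgebra p ⧸ LinearMap.range (Module.Dual.eval (IwasawaAlgebra p) H s)) =
      Module.charIdeal (IwasawaAlgebra p) (H ⧸ (IwasawaAlgebra p) ∙ s) := by
  unfold Module.charIdeal
  exact finprod_mem_congr rfl fun 𝔭 h𝔭 => by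
    rw [lengthAt_quotient_indexIdeal_eq hH s 𝔭 h𝔭]

/-- **Rank one from an embedding and a non-zero element.** A torsion-free `Λ`-module that embeds in
`Λ` and has a non-zero element has rank `1`. [folklore] -/
private theorem rank_eq_one_of_injective [_root_.Module.IsTorsionFree (IwasawaAlgebra p) H]
    (ι : H →ₗ[IwasawaAlgebra p] IwasawaAlgebra p) (hι : Function.Injective ι) {s : H} (hs : s ≠ 0) :
    Module.rank (IwasawaAlgebra p) H = 1 := by
  haveI : Nontrivial H := nontrivial_of_ne s 0 hs
  refine le_antisymm ?_ (Cardinal.one_le_iff_pos.mpr rank_pos)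
  have h := LinearMap.lift_rank_le_of_injective ι hι
  rw [Module.rank_self, Cardinal.lift_one, Cardinal.lift_le_one_iff] at h
  exact h

/-- **The K8 shape**: if `H` is finitely generated and torsion-free over `Λ`, EMBEDS in `Λ` (e.g. by an
injective Coleman map `Col ∘ loc : 𝐇¹_Γ(T_pW) ↪ Λ`, Kobayashi 2003 Thm. 6.2/7.3 i)), and `s ∈ H` is
non-zero (e.g. an Euler-system class with `Col(s) = L_p ≠ 0`), then
`ℓ_𝔭(Λ ⧸ J(s)) = ℓ_𝔭(H ⧸ Λs)` at every height-one `𝔭` — Kato's `length(Λ_𝔭/J_𝔭)` of Thm. 13.4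
equals the quotient form used by the tree's `Kato2004.thm13_4_lengthAt_fineSelmerDual_le_of_isEulerSystemClass`.
[cite: Kato2004Asterisque, Thm. 13.4 (p. 226) and Thm. 12.4 (2) (p. 221)]
[cite: Kobayashi2003, Thm. 6.2 and Thm. 7.3 i) (pp. 11–13)] [cite: Rubin2000, §2.3] -/
theorem lengthAt_quotient_indexIdeal_eq_of_injective [Module.Finite (IwasawaAlgebra p) H]
    [_root_.Module.IsTorsionFree (IwasawaAlgebra p) H]
    (ι : H →ₗ[IwasawaAlgebra p] IwasawaAlgebra p) (hι : Function.Injective ι) {s : H} (hs : s ≠ 0)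
    (𝔭 : PrimeSpectrum (IwasawaAlgebra p)) (h𝔭 : 𝔭.asIdeal.height = 1) :
    Module.lengthAt (IwasawaAlgebra p)
        (IwasawaAlgebra p ⧸ LinearMap.range (Module.Dual.eval (IwasawaAlgebra p) H s)) 𝔭 =
      Module.lengthAt (IwasawaAlgebra p) (H ⧸ (IwasawaAlgebra p) ∙ s) 𝔭 :=
  lengthAt_quotient_indexIdeal_eq (rank_eq_one_of_injective ι hι hs) s 𝔭 h𝔭

end IwasawaAlgebra

end Literature.NumberTheory.EllipticCurves

end
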